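import Summits.QuantumFields.BalabanUV.Beta.FP.CombSliceRowJets
import Summits.QuantumFields.BalabanUV.Beta.FP.PeriodisedBorderTablesSlots

/-!
# `BalabanUV.Beta.FP.NestedSliceDeadJets` — road «FP» for binder row D1, ROUTE T, TID-LETTER-SPEC § B (v): **THE NESTED FADDEEV–POPOV 2-JET VANISHES
# WHEN THE GENERATOR JETS HAVE NO DEAD COMPONENTS IN THE NESTED CHARTS** — the MOVING-frame companion of `CombSliceJetLetters.hUT_of_static` (p310409).
# For the nested slice `[τ₂Q₁₀; τ₁]` of the torus call (`NestedStepLawTorusInstance(Δ)`, p313662) and generator jets `W₁ W₂` (fine) ∕ `D̄₁ D̄₂` (coarse) tied by the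
# displayed MOVING covariance letters `c1 : Q₁₁W₀ + Q₁₀W₁ = [D̄₁|0]`, `c2 : Q₁₂W₀ + 2•(Q₁₁W₁) + Q₁₀W₂ = [D̄₂|0]` (p308750's shapes; leaf-02's
# `PeriodisedBorderWardContactInstance` supplies `c1`): if the fine slice kills the fine jets (`τ₁W₁ = τ₁W₂ = 0`) and the coarse slice kills the coarse jets
# (`τ₂D̄₁ = τ₂D̄₂ = 0`), then BOTH displayed jets of the nested FP operator are ZERO and its `secondVar` vanishes.  For the comb slices of record this is the case
# exactly when the jets vanish on the comb (DEAD) slots — an2's `IsCombBondAt` — i.e. for insertion directions LIVE in the nested charts (the OWNER's (O1),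
# memo §23 (23b) «both FP families static in the small chart»).  Together with `CombSliceRowJets` §4 (one-shot half) the torus call's whole displayed FP defect
# `2·secondVar(P·W-jets) − 2·secondVar(nested jets)` is `0` for directions live in BOTH the one-shot and the nested charts.

HONEST DEPENDENCY (page 1, mandatory): continuum YM on T⁴ ⇐ BetaPertH ∧ nine spine estimates (0/9 proved); BetaPertH ⇐ (D1) ∧ (D4) ∧ CAP+tail;
G-an2-4 gates asym, D1 and NE2/3/4.  HONEST FRAMING (cell contract, verbatim): «discharging `BetaPertH` makes Bałaban's UV stability UNCONDITIONAL —
a real constructive-QFT result; it is NOT the continuum limit and NOT the Clay problem.»  ABSOLUTE RULE (cell charter, verbatim): «No internally-minted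
statement may enter as a cited fact. Every hypothesis is either kernel-proved in this package or a verbatim quotation of a PUBLISHED theorem with page
reference. The manuscript(s) under audit are NOT citable for their own disputed steps — they are the thing under adjudication; programme-internal
(2001/route/tribunal) claims are never citable.»  THIS MODULE is [folklore] finite-matrix bookkeeping (`Matrix.fromRows_mul`, `Matrix.mul_fromCols`, `fromRows`∕`fromCols`
of zeros; leaf-02's `PeriodisedBorderTablesSlots.fromRows_add_add` REUSED) over MY `CombSliceRowJets` ∕ `CombSliceJetLetters` and leaf-06's combs `TorusCombRows`∕`TorusCombNestedBasis`; no `def`, no `def … : Prop`, nothing cited,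
0 sorry; 0 estimates; 0∕4 row-D1 binders.  NOT the letters `c1 c2` (the tables' — leaf-02 ∕ dictionary), NOT the vanishing of the dictionary's jets on the dead slots
(a property of the chosen insertion directions), NOT (T-ID), NOT SDF, NOT D1, NOT BetaPertH, NOT continuum, NOT Clay.  «not in print; our bookkeeping».

CONTENT.
* §1 generic (any index types): `fromRows_mul_mul`, **`nestedJet₁_eq`** ∕ **`nestedJet₂_eq`** (the two displayed nested jets regrouped:
  `= fromRows (τ₂·(Q₁₁W₀ + Q₁₀W₁)) (τ₁W₁)` ∕ `= fromRows (τ₂·(Q₁₂W₀ + 2•Q₁₁W₁ + Q₁₀W₂)) (τ₁W₂)`), `nestedJet₁_eq_zero` ∕ `nestedJet₂_eq_zero` (under `c1 c2` and the four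
  slice-kills), **`hUT_of_dead_letters`** (`secondVar … = 0`).
* §2 comb slices with `id` rows (the torus call's `τ₁ τ₂` typing): **`combSliceId_mul_eq_zero_of_vanish_on_dead`** ∕ `_of_vanish_on_combSlots` (`CombSliceRowJets` §2 at
  `e := Equiv.refl`).
* §3 at the torus call's types: **`hUT_torus_of_vanish_on_dead`** (nested FP 2-jet `= 0` from `c1 c2` + fine jets vanishing on the SMALL comb slots + coarse jets vanishing
  on the COARSE comb slots) and **`fpDefect_torus_eq_zero_of_vanish_on_dead`** (with `CombSliceRowJets.secondVar_bigCombSlice_jets_eq_zero_of_vanish_on_dead`: the whole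
  displayed defect `2·sV(P·[D₂|D₁], P·W₁, P·W₂) − 2·sV(nested jets) = 0`).
Provenance: D1 formalisation swarm LEAF PROVER 06, unit b2b-balaban-beta-d1-formalise-leaf-06 gen 17, 2026-08-22 (TID § B (v) first refusal; OWNER memo §23 (23b)).
No existing file touched.
-/

noncomputable section

namespace Summit.QuantumFields.BalabanUV.Beta.FP.NestedSliceDeadJets

open Finset Matrix
open Literature.MathematicalPhysics.QuantumFieldTheory.Balaban1983to89
open Literature.MathematicalPhysics.QuantumFieldTheory.Balaban1983to89.Beta
open B5Prop11Plancherel (fine)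
open AffineAveraging (Site box toSite)
open B6Lemma24Torus (pbox)
open OneStepResolventKernel (Fib)
open Summit.QuantumFields.BalabanUV.Beta.AxialDressingRooted (IsCombBondAt)
open Summit.QuantumFields.BalabanUV.Beta.D1BFx.LogDetSecondVariation (secondVar)
open Summit.QuantumFields.BalabanUV.Beta.FP.KernelPeriodisationFib (Idx)
open Summit.QuantumFields.BalabanUV.Beta.FP.TorusCombRows (Res combBondT combRowsT)
open Summit.QuantumFields.BalabanUV.Beta.FP.TorusCombNestedBasis (resBigEquiv)
open Summit.QuantumFields.BalabanUV.Beta.FP.CombSliceJetLetters (secondVar_zero_jets)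
open Summit.QuantumFields.BalabanUV.Beta.FP.CombSliceRowJets (combSlice_mul_eq_zero_of_vanish_on_dead isCombBondAt_of_combBondT_eq
  secondVar_bigCombSlice_jets_eq_zero_of_vanish_on_dead)
open Summit.QuantumFields.BalabanUV.Beta.GAN24.FineReadoutCauchyFrame (toSite_mem_range)
open Summit.QuantumFields.BalabanUV.Beta.FP.PeriodisedBorderTablesSlots (fromRows_add_add)

variable {d : ℕ}

/-! ## §1 Generic: the two nested jets regrouped; zero under the moving letters and the slice-kills -/

section Generic

variable {ν μ ρ₁ ρ₂ σ : Type*} [Fintype ν] [Fintype μ]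

/-- [folklore] `fromRows (τ₂·A) B · W = fromRows (τ₂·(A·W)) (B·W)`. -/
theorem fromRows_mul_mul (τ₂ : Matrix ρ₂ μ ℝ) (A : Matrix μ ν ℝ) (B : Matrix ρ₁ ν ℝ) (W : Matrix ν σ ℝ) :
    fromRows (τ₂ * A) B * W = fromRows (τ₂ * (A * W)) (B * W) := by
  rw [Matrix.fromRows_mul, Matrix.mul_assoc]

/-- [folklore] **THE FIRST NESTED JET REGROUPED**: `[τ₂Q₁₁;0]·W₀ + [τ₂Q₁₀;τ₁]·W₁ = [τ₂·(Q₁₁W₀ + Q₁₀W₁); τ₁W₁]`. -/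
theorem nestedJet₁_eq (τ₁ : Matrix ρ₁ ν ℝ) (τ₂ : Matrix ρ₂ μ ℝ) (Q₁₀ Q₁₁ : Matrix μ ν ℝ) (W₀ W₁ : Matrix ν σ ℝ) :
    fromRows (τ₂ * Q₁₁) (0 : Matrix ρ₁ ν ℝ) * W₀ + fromRows (τ₂ * Q₁₀) τ₁ * W₁
      = fromRows (τ₂ * (Q₁₁ * W₀ + Q₁₀ * W₁)) (τ₁ * W₁) := by
  rw [fromRows_mul_mul, fromRows_mul_mul, fromRows_add_add, Matrix.zero_mul, zero_add, Matrix.mul_add]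

/-- [folklore] **THE SECOND NESTED JET REGROUPED**: `[τ₂Q₁₂;0]·W₀ + [τ₂Q₁₁;0]·W₁ + ([τ₂Q₁₁;0]·W₁ + [τ₂Q₁₀;τ₁]·W₂) = [τ₂·(Q₁₂W₀ + 2•(Q₁₁W₁) + Q₁₀W₂); τ₁W₂]`. -/
theorem nestedJet₂_eq (τ₁ : Matrix ρ₁ ν ℝ) (τ₂ : Matrix ρ₂ μ ℝ) (Q₁₀ Q₁₁ Q₁₂ : Matrix μ ν ℝ) (W₀ W₁ W₂ : Matrix ν σ ℝ) :
    fromRows (τ₂ * Q₁₂) (0 : Matrix ρ₁ ν ℝ) * W₀ + fromRows (τ₂ * Q₁₁) (0 : Matrix ρ₁ ν ℝ) * W₁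
        + (fromRows (τ₂ * Q₁₁) (0 : Matrix ρ₁ ν ℝ) * W₁ + fromRows (τ₂ * Q₁₀) τ₁ * W₂)
      = fromRows (τ₂ * (Q₁₂ * W₀ + (2 : ℝ) • (Q₁₁ * W₁) + Q₁₀ * W₂)) (τ₁ * W₂) := by
  rw [fromRows_mul_mul, fromRows_mul_mul, fromRows_mul_mul, fromRows_add_add, fromRows_add_add, fromRows_add_add]
  congr 1
  · rw [two_smul, Matrix.mul_add, Matrix.mul_add, Matrix.mul_add]
    abel
  · simp only [Matrix.zero_mul, zero_add]

/-- [folklore] `fromRows (τ₂ · [D̄|0]) 0 = 0` when `τ₂·D̄ = 0`. -/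
theorem fromRows_mul_fromCols_eq_zero (τ₂ : Matrix ρ₂ μ ℝ) (Db : Matrix μ ρ₂ ℝ) (h : τ₂ * Db = 0) :
    fromRows (τ₂ * fromCols Db (0 : Matrix μ ρ₁ ℝ)) (0 : Matrix ρ₁ (ρ₂ ⊕ ρ₁) ℝ) = 0 := by
  rw [Matrix.mul_fromCols, h, Matrix.mul_zero]
  ext (i | i) (j | j) <;> rfl

/-- [folklore] **THE FIRST NESTED JET IS ZERO** under `c1 : Q₁₁W₀ + Q₁₀W₁ = [D̄₁|0]` and the slice-kills `τ₁W₁ = 0`, `τ₂D̄₁ = 0`. -/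
theorem nestedJet₁_eq_zero (τ₁ : Matrix ρ₁ ν ℝ) (τ₂ : Matrix ρ₂ μ ℝ) (Q₁₀ Q₁₁ : Matrix μ ν ℝ) (W₀ W₁ : Matrix ν (ρ₂ ⊕ ρ₁) ℝ) (Db₁ : Matrix μ ρ₂ ℝ)
    (c1 : Q₁₁ * W₀ + Q₁₀ * W₁ = fromCols Db₁ 0) (hτ₁ : τ₁ * W₁ = 0) (hτ₂ : τ₂ * Db₁ = 0) :
    fromRows (τ₂ * Q₁₁) (0 : Matrix ρ₁ ν ℝ) * W₀ + fromRows (τ₂ * Q₁₀) τ₁ * W₁ = 0 := by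
  rw [nestedJet₁_eq, c1, hτ₁]
  exact fromRows_mul_fromCols_eq_zero τ₂ Db₁ hτ₂

/-- [folklore] **THE SECOND NESTED JET IS ZERO** under `c2 : Q₁₂W₀ + 2•(Q₁₁W₁) + Q₁₀W₂ = [D̄₂|0]` and the slice-kills `τ₁W₂ = 0`, `τ₂D̄₂ = 0`. -/
theorem nestedJet₂_eq_zero (τ₁ : Matrix ρ₁ ν ℝ) (τ₂ : Matrix ρ₂ μ ℝ) (Q₁₀ Q₁₁ Q₁₂ : Matrix μ ν ℝ) (W₀ W₁ W₂ : Matrix ν (ρ₂ ⊕ ρ₁) ℝ) (Db₂ : Matrix μ ρ₂ ℝ)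
    (c2 : Q₁₂ * W₀ + (2 : ℝ) • (Q₁₁ * W₁) + Q₁₀ * W₂ = fromCols Db₂ 0) (hτ₁ : τ₁ * W₂ = 0) (hτ₂ : τ₂ * Db₂ = 0) :
    fromRows (τ₂ * Q₁₂) (0 : Matrix ρ₁ ν ℝ) * W₀ + fromRows (τ₂ * Q₁₁) (0 : Matrix ρ₁ ν ℝ) * W₁
        + (fromRows (τ₂ * Q₁₁) (0 : Matrix ρ₁ ν ℝ) * W₁ + fromRows (τ₂ * Q₁₀) τ₁ * W₂) = 0 := by
  rw [nestedJet₂_eq, c2, hτ₁]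
  exact fromRows_mul_fromCols_eq_zero τ₂ Db₂ hτ₂

variable [Fintype ρ₁] [Fintype ρ₂] [DecidableEq ρ₁] [DecidableEq ρ₂]

/-- [folklore] **`hUT` FROM THE MOVING LETTERS AND THE SLICE-KILLS** (the moving-frame companion of `CombSliceJetLetters.hUT_of_static`): if
`c1 c2` hold with coarse jets `D̄₁ D̄₂`, the fine slice kills the fine jets (`τ₁W₁ = τ₁W₂ = 0`) and the coarse slice kills the coarse jets (`τ₂D̄₁ = τ₂D̄₂ = 0`),
then the displayed nested FP 2-jet of the torus call has `secondVar = 0` — for ANY `W₀`, ANY `Q₁ₖ`. -/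
theorem hUT_of_dead_letters (τ₁ : Matrix ρ₁ ν ℝ) (τ₂ : Matrix ρ₂ μ ℝ) (Q₁₀ Q₁₁ Q₁₂ : Matrix μ ν ℝ) (W₀ W₁ W₂ : Matrix ν (ρ₂ ⊕ ρ₁) ℝ)
    (Db₁ Db₂ : Matrix μ ρ₂ ℝ)
    (c1 : Q₁₁ * W₀ + Q₁₀ * W₁ = fromCols Db₁ 0) (c2 : Q₁₂ * W₀ + (2 : ℝ) • (Q₁₁ * W₁) + Q₁₀ * W₂ = fromCols Db₂ 0)
    (hτ₁W₁ : τ₁ * W₁ = 0) (hτ₁W₂ : τ₁ * W₂ = 0) (hτ₂D₁ : τ₂ * Db₁ = 0) (hτ₂D₂ : τ₂ * Db₂ = 0) :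
    secondVar (fromRows (τ₂ * Q₁₀) τ₁ * W₀)
        (fromRows (τ₂ * Q₁₁) (0 : Matrix ρ₁ ν ℝ) * W₀ + fromRows (τ₂ * Q₁₀) τ₁ * W₁)
        (fromRows (τ₂ * Q₁₂) (0 : Matrix ρ₁ ν ℝ) * W₀ + fromRows (τ₂ * Q₁₁) (0 : Matrix ρ₁ ν ℝ) * W₁
          + (fromRows (τ₂ * Q₁₁) (0 : Matrix ρ₁ ν ℝ) * W₁ + fromRows (τ₂ * Q₁₀) τ₁ * W₂)) = 0 := by
  rw [nestedJet₁_eq_zero τ₁ τ₂ Q₁₀ Q₁₁ W₀ W₁ Db₁ c1 hτ₁W₁ hτ₂D₁, nestedJet₂_eq_zero τ₁ τ₂ Q₁₀ Q₁₁ Q₁₂ W₀ W₁ W₂ Db₂ c2 hτ₁W₂ hτ₂D₂]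
  exact secondVar_zero_jets _

end Generic

/-! ## §2 Comb slices with `id` rows kill matrices vanishing on the comb slots -/

section Comb

variable {N : ℕ} {ρ : Site (d + 1)} {M : Fin (d + 1) → ℕ}

/-- [folklore] **THE COMB SLICE (rows indexed by `Res` itself) KILLS A MATRIX VANISHING ON THE DEAD SLOTS** — `CombSliceRowJets.combSlice_mul_eq_zero_of_vanish_on_dead`
at `e := Equiv.refl`, restated with `id` rows (the torus call's `τ₁`∕`τ₂` typing). -/
theorem combSliceId_mul_eq_zero_of_vanish_on_dead {σ : Type*} (W : Matrix (↥(pbox M) × Fin (d + 1)) σ ℝ)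
    (hW : ∀ (b : ↥(pbox M) × Fin (d + 1)) (x : Res ρ N M), combBondT ρ N M x = ((b.1, Sum.inl b.2) : Idx M (Fib d)) → W b = 0) :
    (combRowsT ρ N M).submatrix id (fun b : ↥(pbox M) × Fin (d + 1) => ((b.1, Sum.inl b.2) : Idx M (Fib d))) * W = 0 :=
  combSlice_mul_eq_zero_of_vanish_on_dead (Equiv.refl _) W hW

/-- [folklore] the same in an2's words: `W` vanishing at every comb slot `(s, α)` with `IsCombBondAt ρ N α s`. -/
theorem combSliceId_mul_eq_zero_of_vanish_on_combSlots {σ : Type*} (hN : 0 < N) (hρ : ∀ i, 0 ≤ ρ i ∧ ρ i < N) (hM : ∀ i, N ∣ M i)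
    (W : Matrix (↥(pbox M) × Fin (d + 1)) σ ℝ) (hW : ∀ b : ↥(pbox M) × Fin (d + 1), IsCombBondAt ρ N b.2 (b.1 : Site (d + 1)) → W b = 0) :
    (combRowsT ρ N M).submatrix id (fun b : ↥(pbox M) × Fin (d + 1) => ((b.1, Sum.inl b.2) : Idx M (Fib d))) * W = 0 :=
  combSliceId_mul_eq_zero_of_vanish_on_dead W fun b _ h => hW b (isCombBondAt_of_combBondT_eq hN hρ hM h)

end Comb

/-! ## §3 At the torus call's types: the nested FP 2-jet, and the whole displayed FP defect, vanish for directions live in both charts -/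

section Torus

variable (M' : Fin (d + 1) → ℕ) {Lc : ℕ} [NeZero Lc] {r r' : Fin (d + 1) → ℕ}

set_option synthInstance.maxSize 1024 in
/-- [folklore] **`hUT` AT THE TORUS CALL's TYPES FOR JETS WITHOUT DEAD COMPONENTS IN THE NESTED CHARTS**: with `τ₁ τ₂` the fine ∕ coarse comb rows of record
(the call's `hτ₁ hτ₂`), the moving letters `c1 c2` (displayed by the call), fine jets `W₁ W₂` vanishing at every SMALL-comb slot and coarse jets `Db₁ Db₂` vanishing
at every COARSE-comb slot, the displayed nested FP 2-jet has `secondVar = 0` — for ANY `W₀` (e.g. `fromCols D₂ D₁`) and ANY `Q₁₀ Q₁₁ Q₁₂`. -/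
theorem hUT_torus_of_vanish_on_dead (hr : r ∈ box (d + 1) Lc) (hr' : r' ∈ box (d + 1) Lc) (hM' : ∀ i, Lc ∣ M' i)
    {τ₁ : Matrix (Res (toSite r) Lc (fine Lc M')) (↥(pbox (fine Lc M')) × Fin (d + 1)) ℝ}
    {τ₂ : Matrix (Res (toSite r') Lc M') (↥(pbox M') × Fin (d + 1)) ℝ}
    (hτ₁ : τ₁ = (combRowsT (toSite r) Lc (fine Lc M')).submatrix id
        (fun b : ↥(pbox (fine Lc M')) × Fin (d + 1) => ((b.1, Sum.inl b.2) : Idx (fine Lc M') (Fib d))))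
    (hτ₂ : τ₂ = (combRowsT (toSite r') Lc M').submatrix id (fun b : ↥(pbox M') × Fin (d + 1) => ((b.1, Sum.inl b.2) : Idx M' (Fib d))))
    (Q₁₀ Q₁₁ Q₁₂ : Matrix (↥(pbox M') × Fin (d + 1)) (↥(pbox (fine Lc M')) × Fin (d + 1)) ℝ)
    (W₀ W₁ W₂ : Matrix (↥(pbox (fine Lc M')) × Fin (d + 1)) (Res (toSite r') Lc M' ⊕ Res (toSite r) Lc (fine Lc M')) ℝ)
    (Db₁ Db₂ : Matrix (↥(pbox M') × Fin (d + 1)) (Res (toSite r') Lc M') ℝ)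
    (c1 : Q₁₁ * W₀ + Q₁₀ * W₁ = fromCols Db₁ 0) (c2 : Q₁₂ * W₀ + (2 : ℝ) • (Q₁₁ * W₁) + Q₁₀ * W₂ = fromCols Db₂ 0)
    (hW₁ : ∀ b : ↥(pbox (fine Lc M')) × Fin (d + 1), IsCombBondAt (toSite r) Lc b.2 (b.1 : Site (d + 1)) → W₁ b = 0)
    (hW₂ : ∀ b : ↥(pbox (fine Lc M')) × Fin (d + 1), IsCombBondAt (toSite r) Lc b.2 (b.1 : Site (d + 1)) → W₂ b = 0)
    (hDb₁ : ∀ a : ↥(pbox M') × Fin (d + 1), IsCombBondAt (toSite r') Lc a.2 (a.1 : Site (d + 1)) → Db₁ a = 0)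
    (hDb₂ : ∀ a : ↥(pbox M') × Fin (d + 1), IsCombBondAt (toSite r') Lc a.2 (a.1 : Site (d + 1)) → Db₂ a = 0) :
    secondVar (fromRows (τ₂ * Q₁₀) τ₁ * W₀)
        (fromRows (τ₂ * Q₁₁) (0 : Matrix (Res (toSite r) Lc (fine Lc M')) (↥(pbox (fine Lc M')) × Fin (d + 1)) ℝ) * W₀ + fromRows (τ₂ * Q₁₀) τ₁ * W₁)
        (fromRows (τ₂ * Q₁₂) (0 : Matrix (Res (toSite r) Lc (fine Lc M')) (↥(pbox (fine Lc M')) × Fin (d + 1)) ℝ) * W₀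
          + fromRows (τ₂ * Q₁₁) (0 : Matrix (Res (toSite r) Lc (fine Lc M')) (↥(pbox (fine Lc M')) × Fin (d + 1)) ℝ) * W₁
          + (fromRows (τ₂ * Q₁₁) (0 : Matrix (Res (toSite r) Lc (fine Lc M')) (↥(pbox (fine Lc M')) × Fin (d + 1)) ℝ) * W₁
            + fromRows (τ₂ * Q₁₀) τ₁ * W₂)) = 0 := by
  have hLc : 0 < Lc := Nat.pos_of_ne_zero (NeZero.ne Lc)
  have hfine : ∀ i, Lc ∣ fine Lc M' i := fun i => ⟨M' i, rfl⟩
  subst hτ₁ hτ₂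
  exact hUT_of_dead_letters _ _ Q₁₀ Q₁₁ Q₁₂ W₀ W₁ W₂ Db₁ Db₂ c1 c2
    (combSliceId_mul_eq_zero_of_vanish_on_combSlots hLc (toSite_mem_range hr) hfine W₁ hW₁)
    (combSliceId_mul_eq_zero_of_vanish_on_combSlots hLc (toSite_mem_range hr) hfine W₂ hW₂)
    (combSliceId_mul_eq_zero_of_vanish_on_combSlots hLc (toSite_mem_range hr') hM' Db₁ hDb₁)
    (combSliceId_mul_eq_zero_of_vanish_on_combSlots hLc (toSite_mem_range hr') hM' Db₂ hDb₂)

set_option synthInstance.maxSize 1024 in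
/-- [folklore] **THE WHOLE DISPLAYED FP DEFECT OF THE TORUS CALL VANISHES FOR DIRECTIONS LIVE IN BOTH CHARTS**: with `P` the one-shot big-comb slice of record
(the call's `hP`), `τ₁ τ₂` the nested comb slices (`hτ₁ hτ₂`), the moving letters `c1 c2`, fine jets `W₁ W₂` vanishing at every BIG-comb slot AND every SMALL-comb slot,
and coarse jets `Db₁ Db₂` vanishing at every COARSE-comb slot:
`2·secondVar (P·W₀) (P·W₁) (P·W₂) − 2·secondVar (nested jets) = 0` — `CombSliceRowJets` §4 + §3 above. -/
theorem fpDefect_torus_eq_zero_of_vanish_on_dead (hr : r ∈ box (d + 1) Lc) (hr' : r' ∈ box (d + 1) Lc) (hM' : ∀ i, Lc ∣ M' i)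
    {τ₁ : Matrix (Res (toSite r) Lc (fine Lc M')) (↥(pbox (fine Lc M')) × Fin (d + 1)) ℝ}
    {τ₂ : Matrix (Res (toSite r') Lc M') (↥(pbox M') × Fin (d + 1)) ℝ}
    {P : Matrix (Res (toSite r') Lc M' ⊕ Res (toSite r) Lc (fine Lc M')) (↥(pbox (fine Lc M')) × Fin (d + 1)) ℝ}
    (hτ₁ : τ₁ = (combRowsT (toSite r) Lc (fine Lc M')).submatrix id
        (fun b : ↥(pbox (fine Lc M')) × Fin (d + 1) => ((b.1, Sum.inl b.2) : Idx (fine Lc M') (Fib d))))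
    (hτ₂ : τ₂ = (combRowsT (toSite r') Lc M').submatrix id (fun b : ↥(pbox M') × Fin (d + 1) => ((b.1, Sum.inl b.2) : Idx M' (Fib d))))
    (hP : P = (combRowsT ((Lc : ℤ) • toSite r' + toSite r) (Lc * Lc) (fine Lc M')).submatrix
        (resBigEquiv Lc Lc (toSite r) (toSite r') M' (Nat.pos_of_ne_zero (NeZero.ne Lc)) (toSite_mem_range hr)
          (Nat.pos_of_ne_zero (NeZero.ne Lc)) (toSite_mem_range hr')).symm
        (fun b : ↥(pbox (fine Lc M')) × Fin (d + 1) => ((b.1, Sum.inl b.2) : Idx (fine Lc M') (Fib d))))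
    (Q₁₀ Q₁₁ Q₁₂ : Matrix (↥(pbox M') × Fin (d + 1)) (↥(pbox (fine Lc M')) × Fin (d + 1)) ℝ)
    (W₀ W₁ W₂ : Matrix (↥(pbox (fine Lc M')) × Fin (d + 1)) (Res (toSite r') Lc M' ⊕ Res (toSite r) Lc (fine Lc M')) ℝ)
    (Db₁ Db₂ : Matrix (↥(pbox M') × Fin (d + 1)) (Res (toSite r') Lc M') ℝ)
    (c1 : Q₁₁ * W₀ + Q₁₀ * W₁ = fromCols Db₁ 0) (c2 : Q₁₂ * W₀ + (2 : ℝ) • (Q₁₁ * W₁) + Q₁₀ * W₂ = fromCols Db₂ 0)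
    (hW₁big : ∀ b : ↥(pbox (fine Lc M')) × Fin (d + 1), IsCombBondAt ((Lc : ℤ) • toSite r' + toSite r) (Lc * Lc) b.2 (b.1 : Site (d + 1)) → W₁ b = 0)
    (hW₂big : ∀ b : ↥(pbox (fine Lc M')) × Fin (d + 1), IsCombBondAt ((Lc : ℤ) • toSite r' + toSite r) (Lc * Lc) b.2 (b.1 : Site (d + 1)) → W₂ b = 0)
    (hW₁ : ∀ b : ↥(pbox (fine Lc M')) × Fin (d + 1), IsCombBondAt (toSite r) Lc b.2 (b.1 : Site (d + 1)) → W₁ b = 0)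
    (hW₂ : ∀ b : ↥(pbox (fine Lc M')) × Fin (d + 1), IsCombBondAt (toSite r) Lc b.2 (b.1 : Site (d + 1)) → W₂ b = 0)
    (hDb₁ : ∀ a : ↥(pbox M') × Fin (d + 1), IsCombBondAt (toSite r') Lc a.2 (a.1 : Site (d + 1)) → Db₁ a = 0)
    (hDb₂ : ∀ a : ↥(pbox M') × Fin (d + 1), IsCombBondAt (toSite r') Lc a.2 (a.1 : Site (d + 1)) → Db₂ a = 0) :
    2 * secondVar (P * W₀) (P * W₁) (P * W₂)
      - 2 * secondVar (fromRows (τ₂ * Q₁₀) τ₁ * W₀)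
          (fromRows (τ₂ * Q₁₁) (0 : Matrix (Res (toSite r) Lc (fine Lc M')) (↥(pbox (fine Lc M')) × Fin (d + 1)) ℝ) * W₀ + fromRows (τ₂ * Q₁₀) τ₁ * W₁)
          (fromRows (τ₂ * Q₁₂) (0 : Matrix (Res (toSite r) Lc (fine Lc M')) (↥(pbox (fine Lc M')) × Fin (d + 1)) ℝ) * W₀
            + fromRows (τ₂ * Q₁₁) (0 : Matrix (Res (toSite r) Lc (fine Lc M')) (↥(pbox (fine Lc M')) × Fin (d + 1)) ℝ) * W₁
            + (fromRows (τ₂ * Q₁₁) (0 : Matrix (Res (toSite r) Lc (fine Lc M')) (↥(pbox (fine Lc M')) × Fin (d + 1)) ℝ) * W₁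
              + fromRows (τ₂ * Q₁₀) τ₁ * W₂)) = 0 := by
  rw [hUT_torus_of_vanish_on_dead M' hr hr' hM' hτ₁ hτ₂ Q₁₀ Q₁₁ Q₁₂ W₀ W₁ W₂ Db₁ Db₂ c1 c2 hW₁ hW₂ hDb₁ hDb₂]
  subst hP
  rw [secondVar_bigCombSlice_jets_eq_zero_of_vanish_on_dead (Nat.pos_of_ne_zero (NeZero.ne Lc)) (toSite_mem_range hr)
    (Nat.pos_of_ne_zero (NeZero.ne Lc)) (toSite_mem_range hr') hM' W₀ W₁ W₂ hW₁big hW₂big]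
  ring

end Torus

end Summit.QuantumFields.BalabanUV.Beta.FP.NestedSliceDeadJets

end
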